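import Mathlib
import HarnessLib
import Summits.Ventures.LatticeQCDFlow.Scoring.MultivariateDeltaMethod
import Summits.Ventures.LatticeQCDFlow.Scoring.IndependentJointLimit

/-!
# The delta method for a RATIO: a joint limit `aₙ((Uₙ, Vₙ) − (u, v)) ⇒ (Z₁, Z₂)` with `v ≠ 0`
# gives `aₙ(Uₙ/Vₙ − u/v) ⇒ Z₁/v − u·Z₂/v²`; for two independent codes the printed SPEED-UP
# RATIO `θ̂ₙ^A/θ̂ₙ^B` is asymptotically normal

HONEST FRAMING: exact (Metropolis-corrected) sampling algorithms for lattice gauge theory;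
figures of merit are autocorrelation/cost numbers at stated couplings and volumes; no
continuum-physics claim.

Venture `LatticeQCDFlow` (cell pub-lqcd), topic `Scoring`; FANOUT row 4 (`s0-u1-b`, rung S0-B).
The three tools landed in this packet compose: the joint limit of two independent codes'
estimates (`Scoring/IndependentJointLimit`), the multivariate delta method
(`Scoring/MultivariateDeltaMethod`) and the Fréchet derivative of `(x, y) ↦ x/y` at a point with
`y ≠ 0` (**`hasFDerivAt_div_prod`**, from Mathlib's `hasFDerivAt_fst`, `hasFDerivAt_snd`,
`hasFDerivAt_inv`, `HasFDerivAt.mul`) give the classical delta method for ratios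
(**`tendstoInDistribution_ratio_deltaMethod`**) and, for two independent codes printing
asymptotically normal estimates `θ̂ₙ^A, θ̂ₙ^B` of positive figures of merit with the same number
of draws, the asymptotic normality of the speed-up RATIO itself:
**`twoCode_ratio_clt`** — `√n(θ̂ₙ^A/θ̂ₙ^B − θ_A/θ_B) ⇒ Z_A/θ_B − θ_A·Z_B/θ_B²` on `P_A ⊗ P_B`
(its studentised logarithm, valid also for unequal sample sizes, is
`Scoring/LogRatioAgreementCLT`).  NEW WORK of the cell (classical; our formalisation); no
definition; nothing cited as a fact.

## Content

* `hasFDerivAt_div_prod` — `D(x/y)(u, v) = v⁻¹·dx − (u/v²)·dy`;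
* **`tendstoInDistribution_ratio_deltaMethod`** — the ratio delta method;
* **`twoCode_ratio_clt`** — two independent codes, equal sample sizes.

NOT CLAIMED: unequal sample sizes for the ratio itself (use the log form); a studentised version
(divide by the plug-in standard error and use Slutsky as in `Scoring/TwoCodeAgreementCLT`).
-/

noncomputable section

namespace Summit.Ventures.LatticeQCDFlow.Scoring.CardConsistency

open MeasureTheory ProbabilityTheory Filter ContinuousLinearMap
open scoped Topology

/-! ## §1 The derivative of the ratio -/

section Derivative

/-- **`D(x/y)` at `(u, v)`, `v ≠ 0`**: the map `z ↦ z.1/z.2` on `ℝ × ℝ` has Fréchet derivative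
`u • ((toSpanSingleton ℝ (−(v²)⁻¹)) ∘ snd) + v⁻¹ • fst`, i.e. `(h, k) ↦ v⁻¹h − (u/v²)k`. [ours] -/
theorem hasFDerivAt_div_prod {u v : ℝ} (hv : v ≠ 0) :
    HasFDerivAt (fun z : ℝ × ℝ => z.1 / z.2)
      (u • ((toSpanSingleton ℝ (-(v ^ 2)⁻¹)).comp (snd ℝ ℝ ℝ)) + v⁻¹ • fst ℝ ℝ ℝ) (u, v) := by
  have h1 : HasFDerivAt (fun z : ℝ × ℝ => z.1) (fst ℝ ℝ ℝ) (u, v) := hasFDerivAt_fst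
  have h2 : HasFDerivAt (fun z : ℝ × ℝ => z.2⁻¹)
      ((toSpanSingleton ℝ (-(v ^ 2)⁻¹)).comp (snd ℝ ℝ ℝ)) (u, v) :=
    (hasFDerivAt_inv hv).comp (u, v) hasFDerivAt_snd
  have hmul := h1.mul h2
  have e : (fun z : ℝ × ℝ => z.1 / z.2) = (fun z : ℝ × ℝ => z.1) * fun z : ℝ × ℝ => z.2⁻¹ := by
    funext z
    simp [div_eq_mul_inv]
  rw [e]
  exact hmul

/-- The derivative applied: `L(h, k) = h/v − u·k/v²`. [ours] -/
theorem div_prod_fderiv_apply (u v h k : ℝ) :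
    (u • ((toSpanSingleton ℝ (-(v ^ 2)⁻¹)).comp (snd ℝ ℝ ℝ)) + v⁻¹ • fst ℝ ℝ ℝ) (h, k)
      = h / v - u * k / v ^ 2 := by
  simp [toSpanSingleton_apply]
  ring

end Derivative

/-! ## §2 The ratio delta method -/

section Ratio

variable {Ω : Type*} [MeasurableSpace Ω] {P : Measure Ω} [IsProbabilityMeasure P]
variable {Ω' : Type*} [MeasurableSpace Ω'] {P' : Measure Ω'} [IsProbabilityMeasure P']

/-- **THE DELTA METHOD FOR A RATIO.**  Real statistics `Uₙ, Vₙ` (a.e.-measurable), centrings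
`u, v` with `v ≠ 0`, rates `aₙ → ∞` with the JOINT limit
`(aₙ(Uₙ − u), aₙ(Vₙ − v)) ⇒ (Z₁, Z₂)` in `ℝ × ℝ`.  Then
`aₙ(Uₙ/Vₙ − u/v) ⇒ Z₁/v − u·Z₂/v²`. [ours] -/
theorem tendstoInDistribution_ratio_deltaMethod {U V : ℕ → Ω → ℝ} {u v : ℝ} (hv : v ≠ 0)
    {a : ℕ → ℝ} (ha : Tendsto a atTop atTop) {Z₁ Z₂ : Ω' → ℝ}
    (h : TendstoInDistribution (fun n ω => (a n * (U n ω - u), a n * (V n ω - v))) atTop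
      (fun ω' => (Z₁ ω', Z₂ ω')) (fun _ => P) P')
    (hUm : ∀ n, AEMeasurable (U n) P) (hVm : ∀ n, AEMeasurable (V n) P) :
    TendstoInDistribution (fun n ω => a n * (U n ω / V n ω - u / v)) atTop
      (fun ω' => Z₁ ω' / v - u * Z₂ ω' / v ^ 2) (fun _ => P) P' := by
  have h' : TendstoInDistribution (fun n ω => a n • ((U n ω, V n ω) - (u, v))) atTop
      (fun ω' => (Z₁ ω', Z₂ ω')) (fun _ => P) P' := by
    refine h.congr (fun n => Eventually.of_forall fun ω => ?_) (Eventually.of_forall fun _ => rfl)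
    simp only [Prod.mk_sub_mk, Prod.smul_mk, smul_eq_mul]
  have hg : Measurable fun z : ℝ × ℝ => z.1 / z.2 := measurable_fst.div measurable_snd
  have hd := tendstoInDistribution_deltaMethod_fderiv ha h' (fun n => (hUm n).prodMk (hVm n))
    (hasFDerivAt_div_prod (u := u) hv) hg
  refine hd.congr (fun n => Eventually.of_forall fun ω => ?_) (Eventually.of_forall fun ω' => ?_)
  · simp only [smul_eq_mul]
  · exact div_prod_fderiv_apply u v (Z₁ ω') (Z₂ ω')

end Ratio

/-! ## §3 Two independent codes: the speed-up ratio -/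

section TwoCodes

variable {ΩA : Type*} [MeasurableSpace ΩA] {PA : Measure ΩA} [IsProbabilityMeasure PA]
variable {ΩB : Type*} [MeasurableSpace ΩB] {PB : Measure ΩB} [IsProbabilityMeasure PB]
variable {Ω' : Type*} [MeasurableSpace Ω'] {P' : Measure Ω'} [IsProbabilityMeasure P']

/-- **THE PRINTED SPEED-UP RATIO OF TWO INDEPENDENT CODES IS ASYMPTOTICALLY NORMAL.**  Codes `A`,
`B` print a.e.-measurable estimates `θ̂ₙ^A, θ̂ₙ^B` with `√n(θ̂ₙ^A − θ_A) ⇒ Z_A` under `P_A`,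
`√n(θ̂ₙ^B − θ_B) ⇒ Z_B` under `P_B`, `θ_B ≠ 0`, `Z_A ⟂ Z_B`.  Then on `P_A ⊗ P_B`:
`√n(θ̂ₙ^A/θ̂ₙ^B − θ_A/θ_B) ⇒ Z_A/θ_B − θ_A·Z_B/θ_B²`. [ours] -/
theorem twoCode_ratio_clt {SA : ℕ → ΩA → ℝ} {SB : ℕ → ΩB → ℝ} {θA θB : ℝ} (hθB : θB ≠ 0)
    {ZA ZB : Ω' → ℝ} (hSAm : ∀ n, AEMeasurable (SA n) PA) (hSBm : ∀ n, AEMeasurable (SB n) PB)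
    (hcltA : TendstoInDistribution (fun (n : ℕ) ω => Real.sqrt n * (SA n ω - θA)) atTop ZA
      (fun _ => PA) P')
    (hcltB : TendstoInDistribution (fun (n : ℕ) ω => Real.sqrt n * (SB n ω - θB)) atTop ZB
      (fun _ => PB) P') (hZ : IndepFun ZA ZB P') :
    TendstoInDistribution (fun (n : ℕ) (ω : ΩA × ΩB) =>
        Real.sqrt n * (SA n ω.1 / SB n ω.2 - θA / θB))
      atTop (fun ω' => ZA ω' / θB - θA * ZB ω' / θB ^ 2) (fun _ => PA.prod PB) P' := by
  have hjoint := tendstoInDistribution_prodMk_twoCodes hcltA hcltB hZ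
  exact tendstoInDistribution_ratio_deltaMethod (P := PA.prod PB)
    (U := fun n (ω : ΩA × ΩB) => SA n ω.1) (V := fun n (ω : ΩA × ΩB) => SB n ω.2) hθB
    (Real.tendsto_sqrt_atTop.comp tendsto_natCast_atTop_atTop) hjoint
    (fun n => (hSAm n).comp_quasiMeasurePreserving Measure.quasiMeasurePreserving_fst)
    (fun n => (hSBm n).comp_quasiMeasurePreserving Measure.quasiMeasurePreserving_snd)

end TwoCodes

end Summit.Ventures.LatticeQCDFlow.Scoring.CardConsistency

end
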